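import Literature.NumberTheory.DiophantineApproximation.PAdicNesterenkoCriterion
import Literature.NumberTheory.DiophantineApproximation.PAdicNesterenkoCriterionCore
import Mathlib.LinearAlgebra.Dimension.Free
import Mathlib.LinearAlgebra.Dimension.Finite
import Mathlib.LinearAlgebra.FiniteDimensional.Defs
import HarnessLib

/-!
# The `p`-adic Nesterenko criterion over `ℚ` (Sprang 2020, Thm 1.4, `K = ℚ`) — PROVED

Topic `Literature/NumberTheory/DiophantineApproximation`. This file DISCHARGES the named fact
`sprang2020_theorem14_rat` of `PAdicNesterenkoCriterion.lean` (statement file untouched):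
`theorem sprang2020_theorem14_rat_holds : sprang2020_theorem14_rat`.

The statement [Sprang2020, Thm 1.4, `K = ℚ`]: `θ ∈ ℚ_p^s`, integer forms
`Λ_n = λ_{0,n}X₀ + ⋯ + λ_{s,n}X_s` with `max_i |λ_{i,n}| ≤ e^{σ(n)(τ+o(1))}` and
`e^{−(τ₁+o(1))σ(n)} ≤ |Λ_n(1,θ)|_p ≤ e^{−(τ₂−o(1))σ(n)}` (`τ, τ₁, τ₂ > 0`, `σ` non-decreasing positive,
`σ(n) → ∞`, `σ(n+1)/σ(n) → 1`) imply `dim_ℚ(ℚ + ℚθ₁ + ⋯ + ℚθ_s) ≥ τ₁/(τ + τ₁ − τ₂)`. Sprang: "The present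
criterion is proven in the case `K = ℚ` by Chantanasiri" — and the proof formalised here is indeed
Chantanasiri's [Chantanasiri2012, §2.2 Thm 2.4] (pigeonhole in place of Minkowski), NOT the
determinant induction of [Sprang2020, §9]; the core is `PAdicNesterenkoCriterion.core`.

Reduction (this file, [Sprang2020, §9, "Proof of Thm 1.4"]): let `W = ℚ + ℚθ₁ + ⋯ + ℚθ_s ⊂ ℚ_p`,
`dim W = m + 1 ≥ 1`; take a `ℚ`-basis `b` of `W` (`Module.finBasisOfFinrankEq`) re-indexed so that
`b₀` has maximal `p`-adic norm, and put `ξ_j = b_j/b₀` (`ξ₀ = 1`, `‖ξ_j‖_p ≤ 1`). With a common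
denominator `D` of the coordinates of `1, θ_i` in `b`, the integer forms
`l_{n,j} = Σ_i λ_{i,n} C_{ij}` (`C_{ij} = D · coord`) satisfy `Σ_j l_{n,j} ξ_j = (D/b₀) Λ_n(1,θ)`, so
they inherit the rates (constants are `e^{o(1)σ(n)}` since `σ → ∞`), and `core` gives
`τ₁/(τ+τ₁−τ₂) ≤ m + 1 = dim W`. The typed hypotheses `Monotone σ`, `0 < σ n`, `0 < τ₂` are not needed.

Cell pub-zeta5 (HONEST FRAMING): a linear independence CRITERION made a theorem of the tree; nothing
here concerns `ζ(5)`; it is the criterion behind the (untouched, undischarged) `p`-adic records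
`PAdicZetaValues.sprang2020_corollary12_rat`, `….lai2024_theorem12`.

## References

* J. Sprang, *Linear independence result for p-adic L-values*, Duke Math. J. 169 (2020) 3439–3476,
  Thm 1.4 and §9. [Sprang2020] (held: `paper:arxiv-1809.07714`, pp. 4, 16–17.)
* A. Chantanasiri, Ann. Math. Blaise Pascal 19 (2012) 75–105, §2.2 Thm 2.4. [Chantanasiri2012]
-/

noncomputable section

open Filter Finset
open scoped Topology

namespace Literature.NumberTheory.DiophantineApproximation

open PAdicNesterenkoCriterion in
/-- **Sprang 2020, Theorem 1.4 for `K = ℚ` (Chantanasiri's `p`-adic Nesterenko criterion) — PROVED.**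
Discharges the named fact `sprang2020_theorem14_rat`: reduction to a `ℚ`-basis of
`W = ℚ + ℚθ₁ + ⋯ + ℚθ_s` normalised to a `p`-adic unit coordinate of maximal norm, common
denominator, then `PAdicNesterenkoCriterion.core` with `m + 1 = dim W`.
[cite: Sprang2020, Thm 1.4 (§1; proof §9)] [cite: Chantanasiri2012, Thm 2.4] -/
theorem sprang2020_theorem14_rat_holds : sprang2020_theorem14_rat := by
  intro p _ s θ τ₁ τ₂ τ σ lam hτ₁ _hτ₂ hτ _hmono _hpos hσ hσ1 hyp
  obtain ⟨δ₁, δ₂, δ₃, hδ₁, hδ₂, hδ₃, hev⟩ := hyp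
  classical
  have hp : p.Prime := Fact.out
  -- the span `W` and a basis indexed by `Fin (m+1)`
  set W : Submodule ℚ ℚ_[p] := Submodule.span ℚ (insert (1 : ℚ_[p]) (Set.range θ)) with hW
  have hfin : (insert (1 : ℚ_[p]) (Set.range θ)).Finite := (Set.finite_range θ).insert 1
  haveI : FiniteDimensional ℚ W := FiniteDimensional.span_of_finite ℚ hfin
  have h1W : (1 : ℚ_[p]) ∈ W := Submodule.subset_span (Set.mem_insert _ _)
  have hθW : ∀ i, θ i ∈ W := fun i => Submodule.subset_span (Set.mem_insert_of_mem _ ⟨i, rfl⟩)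
  have hd0 : 0 < Module.finrank ℚ W :=
    Module.finrank_pos_iff_exists_ne_zero.mpr ⟨⟨1, h1W⟩, by simp⟩
  obtain ⟨m, hm⟩ : ∃ m, Module.finrank ℚ W = m + 1 := ⟨Module.finrank ℚ W - 1, by omega⟩
  let b₀ : Module.Basis (Fin (m + 1)) ℚ W := Module.finBasisOfFinrankEq ℚ W hm
  obtain ⟨j₀, -, hj₀⟩ :=
    Finset.exists_max_image Finset.univ (fun j => ‖(b₀ j : ℚ_[p])‖) Finset.univ_nonempty
  let b : Module.Basis (Fin (m + 1)) ℚ W := b₀.reindex (Equiv.swap 0 j₀)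
  have hb : ∀ j, b j = b₀ (Equiv.swap 0 j₀ j) := fun j => by
    rw [Module.Basis.reindex_apply, Equiv.symm_swap]
  set u : ℚ_[p] := (b 0 : ℚ_[p]) with hu
  have hu0 : u ≠ 0 := by
    rw [hu]; intro h
    exact b.ne_zero 0 ((Submodule.coe_eq_zero).mp h)
  have hmax : ∀ j, ‖(b j : ℚ_[p])‖ ≤ ‖u‖ := by
    intro j
    rw [hu, hb, hb, Equiv.swap_apply_left]
    exact hj₀ _ (Finset.mem_univ _)
  have hupos : 0 < ‖u‖ := norm_pos_iff.mpr hu0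
  -- normalised coordinates
  set ξ : Fin (m + 1) → ℚ_[p] := fun j => (b j : ℚ_[p]) / u with hξ_def
  have hξ0 : ξ 0 = 1 := by simp only [hξ_def, hu]; exact div_self hu0
  have hξ : ∀ j, ‖ξ j‖ ≤ 1 := fun j => by
    simp only [hξ_def]; rw [norm_div, div_le_one hupos]; exact hmax j
  -- the generators `1, θ_i` as elements of `W`, and their coordinates
  let g : Fin (s + 1) → W := Fin.cases ⟨1, h1W⟩ (fun i => ⟨θ i, hθW i⟩)
  have hg0 : ((g 0 : W) : ℚ_[p]) = 1 := by simp [g]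
  have hgs : ∀ i : Fin s, ((g i.succ : W) : ℚ_[p]) = θ i := fun i => by simp [g]
  have hexp : ∀ x : W, (x : ℚ_[p]) = ∑ j, ((b.repr x j : ℚ) : ℚ_[p]) * (b j : ℚ_[p]) := by
    intro x
    conv_lhs => rw [← b.sum_repr x]
    rw [Submodule.coe_sum]
    refine Finset.sum_congr rfl fun j _ => ?_
    rw [Submodule.coe_smul, Rat.smul_def]
  -- a common denominator
  set q : Fin (s + 1) → Fin (m + 1) → ℚ := fun i j => b.repr (g i) j with hq
  set D : ℕ := ∏ ij : Fin (s + 1) × Fin (m + 1), (q ij.1 ij.2).den with hD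
  have hD0 : 0 < D := Finset.prod_pos fun ij _ => (q ij.1 ij.2).den_pos
  have hCex : ∀ i j, ∃ z : ℤ, (z : ℚ) = (D : ℚ) * q i j := by
    intro i j
    obtain ⟨R, hR⟩ := Finset.dvd_prod_of_mem (fun ij : Fin (s + 1) × Fin (m + 1) => (q ij.1 ij.2).den)
      (Finset.mem_univ (i, j))
    refine ⟨(R : ℤ) * (q i j).num, ?_⟩
    have hR' : (D : ℚ) = ((q i j).den : ℚ) * (R : ℚ) := by rw [hD, hR]; push_cast; ring
    rw [hR', Int.cast_mul, Int.cast_natCast, mul_comm ((q i j).den : ℚ), mul_assoc,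
      Rat.den_mul_eq_num]
  choose C hC using hCex
  -- integer forms in the normalised coordinates
  set l : ℕ → Fin (m + 1) → ℤ := fun n j => ∑ i, lam n i * C i j with hl
  set Λ : ℕ → ℚ_[p] := fun n => (lam n 0 : ℚ_[p]) + ∑ i : Fin s, (lam n i.succ : ℚ_[p]) * θ i with hΛ
  set L : ℕ → ℚ_[p] := fun n => ∑ j, (l n j : ℚ_[p]) * ξ j with hL
  have hCcast : ∀ i j, ((C i j : ℤ) : ℚ_[p]) = (D : ℚ_[p]) * ((q i j : ℚ) : ℚ_[p]) := by
    intro i j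
    rw [show ((C i j : ℤ) : ℚ_[p]) = ((C i j : ℚ) : ℚ_[p]) by norm_cast, hC]; push_cast; ring
  have hexpD : ∀ i, ∑ j, ((C i j : ℤ) : ℚ_[p]) * ξ j = (D : ℚ_[p]) / u * (g i : ℚ_[p]) := by
    intro i
    rw [hexp (g i), Finset.mul_sum]
    refine Finset.sum_congr rfl fun j _ => ?_
    rw [hCcast]; simp only [hξ_def, hq]
    field_simp
  have hΛg : ∀ n, Λ n = ∑ i : Fin (s + 1), (lam n i : ℚ_[p]) * (g i : ℚ_[p]) := by
    intro n
    rw [Fin.sum_univ_succ, hg0, mul_one]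
    simp only [hΛ, hgs]
  have hLΛ : ∀ n, L n = (D : ℚ_[p]) / u * Λ n := by
    intro n
    calc L n = ∑ j, ∑ i, (lam n i : ℚ_[p]) * ((C i j : ℤ) : ℚ_[p]) * ξ j := by
          simp only [hL, hl, Int.cast_sum, Int.cast_mul, Finset.sum_mul]
      _ = ∑ i, (lam n i : ℚ_[p]) * ∑ j, ((C i j : ℤ) : ℚ_[p]) * ξ j := by
          rw [Finset.sum_comm]
          refine Finset.sum_congr rfl fun i _ => ?_
          rw [Finset.mul_sum]
          refine Finset.sum_congr rfl fun j _ => ?_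
          ring
      _ = (D : ℚ_[p]) / u * Λ n := by
          rw [hΛg, Finset.mul_sum]
          refine Finset.sum_congr rfl fun i _ => ?_
          rw [hexpD]; ring
  set κ : ℝ := ‖(D : ℚ_[p]) / u‖ with hκ
  have hκ0 : 0 < κ := by
    rw [hκ, norm_pos_iff]
    exact div_ne_zero (by exact_mod_cast hD0.ne') hu0
  have hnormL : ∀ n, ‖L n‖ = κ * ‖Λ n‖ := fun n => by rw [hLΛ, norm_mul]
  -- apply the core
  have hfr : (Module.finrank ℚ W : ℝ) = (m : ℝ) + 1 := by rw [hm]; push_cast; ring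
  rw [hfr]
  refine core m ξ hξ0 hξ l L (fun n => rfl) hτ₁.le hτ hσ hσ1 fun ε hε => ?_
  -- the `ε`-form of the hypotheses
  set Cst : ℝ := ∑ i : Fin (s + 1), ∑ j : Fin (m + 1), (|C i j| : ℝ) + 1 with hCst
  have hCst1 : 1 ≤ Cst := by
    have : 0 ≤ ∑ i : Fin (s + 1), ∑ j : Fin (m + 1), (|C i j| : ℝ) :=
      Finset.sum_nonneg fun i _ => Finset.sum_nonneg fun j _ => by positivity
    linarith
  set T : ℝ := 2 / ε * max (Real.log Cst) (|Real.log κ|) with hT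
  have hε2 : 0 < ε / 2 := by linarith
  filter_upwards [hev, hδ₁.eventually (eventually_lt_nhds hε2), hδ₂.eventually (eventually_lt_nhds hε2),
    hδ₃.eventually (eventually_lt_nhds hε2), hσ.eventually_ge_atTop T, hσ.eventually_gt_atTop 0]
    with n hn h1 h2 h3 hTn hσn
  obtain ⟨hlam, hlo, hhi⟩ := hn
  have hM : max (Real.log Cst) (|Real.log κ|) ≤ ε / 2 * σ n := by
    have h := mul_le_mul_of_nonneg_left hTn hε2.le
    have h' : ε / 2 * T = max (Real.log Cst) (|Real.log κ|) := by rw [hT]; field_simp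
    linarith
  have hT1 : Real.log Cst ≤ ε / 2 * σ n := (le_max_left _ _).trans hM
  have hT2 : |Real.log κ| ≤ ε / 2 * σ n := (le_max_right _ _).trans hM
  have hκup : κ ≤ Real.exp (ε / 2 * σ n) := by
    rw [← Real.exp_log hκ0]; exact Real.exp_le_exp.mpr ((le_abs_self _).trans hT2)
  have hκlo : Real.exp (-(ε / 2 * σ n)) ≤ κ := by
    rw [← Real.exp_log hκ0]; exact Real.exp_le_exp.mpr (by linarith [neg_abs_le (Real.log κ)])
  have hCstup : Cst ≤ Real.exp (ε / 2 * σ n) := by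
    rw [← Real.exp_log (by linarith : (0:ℝ) < Cst)]; exact Real.exp_le_exp.mpr hT1
  refine ⟨fun j => ?_, ?_, ?_⟩
  · -- height
    have h1 : (|l n j| : ℝ) ≤ Real.exp (σ n * (τ + δ₁ n)) * Cst := by
      simp only [hl]
      push_cast
      refine (Finset.abs_sum_le_sum_abs _ _).trans ?_
      have h2 : ∀ i ∈ Finset.univ, |((lam n i : ℝ)) * (C i j : ℝ)| ≤
          Real.exp (σ n * (τ + δ₁ n)) * (|C i j| : ℝ) := by
        intro i _
        rw [abs_mul]
        exact mul_le_mul_of_nonneg_right (hlam i) (abs_nonneg _)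
      refine (Finset.sum_le_sum h2).trans ?_
      rw [← Finset.mul_sum]
      refine mul_le_mul_of_nonneg_left ?_ (Real.exp_pos _).le
      rw [hCst]
      have h3 : ∀ i ∈ (Finset.univ : Finset (Fin (s + 1))), (|C i j| : ℝ) ≤ ∑ j', (|C i j'| : ℝ) :=
        fun i _ => Finset.single_le_sum (f := fun j' => (|C i j'| : ℝ)) (fun j' _ => abs_nonneg _)
          (Finset.mem_univ j)
      linarith [Finset.sum_le_sum h3]
    refine h1.trans ?_
    calc Real.exp (σ n * (τ + δ₁ n)) * Cst ≤ Real.exp (σ n * (τ + ε / 2)) * Real.exp (ε / 2 * σ n) := by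
          refine mul_le_mul (Real.exp_le_exp.mpr ?_) hCstup (by positivity) (Real.exp_pos _).le
          exact mul_le_mul_of_nonneg_left (by linarith) hσn.le
      _ = Real.exp ((τ + ε) * σ n) := by rw [← Real.exp_add]; ring_nf
  · -- lower bound
    rw [hnormL]
    calc Real.exp (-(τ₁ + ε) * σ n) = Real.exp (-(ε / 2 * σ n)) * Real.exp (-(τ₁ + ε / 2) * σ n) := by
          rw [← Real.exp_add]; ring_nf
      _ ≤ κ * ‖Λ n‖ := by
          refine mul_le_mul hκlo ?_ (Real.exp_pos _).le hκ0.le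
          refine le_trans (Real.exp_le_exp.mpr ?_) hlo
          nlinarith
  · -- upper bound
    rw [hnormL]
    calc κ * ‖Λ n‖ ≤ Real.exp (ε / 2 * σ n) * Real.exp (-(τ₂ - ε / 2) * σ n) := by
          refine mul_le_mul hκup (hhi.trans (Real.exp_le_exp.mpr ?_)) (norm_nonneg _) (Real.exp_pos _).le
          nlinarith
      _ = Real.exp (-(τ₂ - ε) * σ n) := by rw [← Real.exp_add]; ring_nf

end Literature.NumberTheory.DiophantineApproximation
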